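import Summits.CriticalPhenomena.SAWScalingLimit.Theorems.SAWDevelopingMapInteriorFlatteningOneMouthDefs
import Summits.CriticalPhenomena.SAWScalingLimit.Theorems.SAWDefectDecoherenceDefectDecoherenceTmAdmissible

/-!
# One-mouth sub-balls are simply connected (stub `stub_oneMouthSimplyConnected`, S2 of the line `one-mouth-ball-reduction`, crux `InteriorFlattening`)

Crux `stmt-CriticalPhenomena-8297`
(`Summit.CriticalPhenomena.SAWScalingLimit.Theses.SAWDevelopingMap.InteriorFlattening`), line
`one-mouth-ball-reduction`, registered stub `stub_oneMouthSimplyConnected` (`= OneMouthSimplyConnected`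
of the lead's skeleton). Pure lattice topology, no observable.

**Statement.** Let `S = B(v, r) = {w | dist (c_w, c_v) ≤ r}` be a Euclidean ball of vertices of the
hexagonal lattice `ℍ` (any real `r`), and let `γ` be a self-avoiding walk (`HexMidEdgeSAW Λ a z`, in any
domain `Λ`, between any mid-edges) visiting at least one vertex outside `S`. Then the inner domain
`D = S ∖ γ` left behind is simply connected: `hexDomainSimplyConnected (S \ γ.verts.toFinset)`, i.e.
the subgraph of `ℍ` induced on `Dᶜ = Sᶜ ∪ γ` is preconnected.

**Proof.** The exterior `{w | r < dist (c_w, c_v)}` of the ball is preconnected in `ℍ`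
(`exterior_preconnected` of `…Theorems.SAWDefectDecoherenceDefectDecoherenceTmExterior`: every vertex has a
neighbour farther from `c_v`, so exterior vertices escape to infinity, and far vertices are routed along a
large lattice frame around the ball). It is contained in `Dᶜ`, and every other vertex of `Dᶜ` lies on
`γ`, whose vertex list is a chain of adjacent vertices all in `Dᶜ` containing a vertex `t ∉ S` of the
exterior; walking along `γ` to `t` attaches it to the exterior inside `Dᶜ` (`preconnected_of_attached`,
`pathIn_of_isChain` of `…Theorems.SAWDefectDecoherenceDefectDecoherenceTmAdmissible`).

Sources: H. Duminil-Copin, S. Smirnov, *The connective constant of the honeycomb lattice equals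
`√(2+√2)`*, Ann. of Math. 175 (2012) 1653–1665 (arXiv:1007.0575), §2 (domains "having a connected
complement"); the line card `Cruxes/InteriorFlattening/Lines/one-mouth-ball-reduction.md`. Sorry-free;
axioms `propext`, `Classical.choice`, `Quot.sound`.
-/

namespace Summit.CriticalPhenomena.SAWScalingLimit.Theorems.InteriorFlattening.OneMouth

open Literature.Probability.LatticeModels Literature.Probability.RandomPlanarGeometry.SAW
open scoped BigOperators
open Literature.Probability.Percolation (PathIn)
open Summit.CriticalPhenomena.SAWScalingLimit.Theorems.DefectDecoherence.TipMartingale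
  (exterior_preconnected preconnected_of_attached pathIn_of_isChain)

/-- Any two members of a chain of adjacent vertices of `ℍ` lying inside `C` are joined inside `C`.
[folklore] -/
theorem pathIn_of_mem_isChain {C : Set HexVertex} {l : List HexVertex}
    (hc : l.IsChain hexGraph.Adj) (hC : ∀ y ∈ l, y ∈ C) {x y : HexVertex} (hx : x ∈ l)
    (hy : y ∈ l) : PathIn hexGraph C x y := by
  cases l with
  | nil => exact absurd hx List.not_mem_nil
  | cons z l => exact (pathIn_of_isChain hc hC x hx).symm.trans (pathIn_of_isChain hc hC y hy)

/-- **S2 — one-mouth sub-balls are simply connected.** For the Euclidean lattice ball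
`S = B(v, r)` (any real `r`) and any self-avoiding walk `γ` with a vertex outside `S`, the inner
domain `S ∖ γ` has a connected complement: the complement is the exterior of the ball (preconnected,
`exterior_preconnected`) together with the vertices of `γ`, which hang off it along `γ` itself.
[folklore] -/
theorem stub_oneMouthSimplyConnected :
    ∀ (v : HexVertex) (r : ℝ) (S : Finset HexVertex),
      (∀ w : HexVertex, w ∈ S ↔ dist (hexCenter w) (hexCenter v) ≤ r) →
      ∀ (Λ : Finset HexVertex) (a z : Sym2 HexVertex) (γ : HexMidEdgeSAW Λ a z),
        (∃ t ∈ γ.verts, t ∉ S) → hexDomainSimplyConnected (S \ γ.verts.toFinset) := by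
  intro v r S hS Λ a z γ ht
  obtain ⟨t, htγ, htS⟩ := ht
  unfold hexDomainSimplyConnected
  have hmemC : ∀ x : HexVertex, x ∈ ((↑(S \ γ.verts.toFinset) : Set HexVertex)ᶜ) ↔
      (x ∈ S → x ∈ γ.verts) := fun x => by
    simp only [Set.mem_compl_iff, Finset.mem_coe, Finset.mem_sdiff, List.mem_toFinset, not_and,
      not_not]
  have hsub : {x : HexVertex | r < dist (hexCenter x) (hexCenter v)} ⊆
      ((↑(S \ γ.verts.toFinset) : Set HexVertex)ᶜ) := fun x hx =>
    (hmemC x).2 fun hxS => absurd ((hS x).1 hxS) (not_le.2 hx)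
  have hγC : ∀ y ∈ γ.verts, y ∈ ((↑(S \ γ.verts.toFinset) : Set HexVertex)ᶜ) := fun y hy =>
    (hmemC y).2 fun _ => hy
  refine preconnected_of_attached (exterior_preconnected v r) hsub fun x hx => ?_
  by_cases hxr : r < dist (hexCenter x) (hexCenter v)
  · exact ⟨x, hxr, PathIn.refl hx⟩
  · have hxγ : x ∈ γ.verts := (hmemC x).1 hx ((hS x).2 (not_lt.1 hxr))
    have htr : r < dist (hexCenter t) (hexCenter v) := not_le.1 fun h => htS ((hS t).2 h)
    exact ⟨t, htr, pathIn_of_mem_isChain γ.isChain hγC hxγ htγ⟩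

end Summit.CriticalPhenomena.SAWScalingLimit.Theorems.InteriorFlattening.OneMouth
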